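import Summits.Ventures.CertifiedManyBodySolver.Upper.DWaveSourceOpenClusterCap
import Summits.Ventures.CertifiedManyBodySolver.Observables.PinningFieldChords
import HarnessLib

/-!
# PINNING-FIELD chords, part 4: readers from an open-cluster CAP certificate to the response leaves

HONEST FRAMING: first certified bounds; not a superconductivity verdict; every number certified or
labelled float. Soundness wrappers only; no number is claimed here. A finite-`h` response FLOOR is an
instrument statement (large-field response), NOT an order parameter and NOT a phase word; a ceiling never
speaks to presence.

Cell hubbard-obs / hubbard-cq (seat hubbard-obs-pin-1; consumer of `Upper/DWaveSourceOpenClusterCap.lean`).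
The producer-side soundness `sourcedEnergyUpperRow_of_exists_clusterState` turns a cluster certificate in the
shape

  `∃ ψ : Fock (Orb (Fin a ×ₗ Fin b)), HasParity 0 ψ ∧ star ψ ⬝ᵥ ψ = 1 ∧ Re⟨ψ, dWaveSourceOpenBox a b U μ h ψ⟩ ≤ hi·(ab)`

(an even unit vector of the OPEN sourced `a × b` cluster with Rayleigh quotient `≤ hi` per site — e.g. the
normalisation of an exact-integer `S^z = 0` vector with a certified exact-rational quotient) into the uniform cap
row `SourcedEnergyUpperRow 0 U μ h q L₁ hi` (`a ∣ q`, `b ∣ q`, `a, b < L₁`). This file composes it with the chord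
leaves of `Observables/PinningFieldChords.lean`:

* `PinFieldResponseFloorAt.of_sourcedLower_of_clusterCap` — FLOOR leaf at field `h` from a sourced energy FLOOR
  row at a smaller field `h₁ < h` (any side progression, e.g. a `q = 1` window certificate; weakened to `q`) and
  a cluster cap AT `h`: `m · 2(h − h₁) ≤ lo − hi` ⇒ `PinFieldResponseFloorAt 0 U μ h q (max L₀ L₁) m`
  (`m ≤ m_L(μ; h)` for every `L ≥ max L₀ L₁` with `q ∣ L`). The cluster cap IS a cap of the sourced problem at
  `h` (not inherited from a smaller field), so the honesty node `floorSlot_nonpos_of_transported_cap` does not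
  apply: the slot is positive as soon as the cluster energy at `h` beats the certified floor at `h₁`;
* `PinFieldResponseCeilingAt.of_clusterCap_of_sourcedLower` — CEILING leaf at `h` from the cluster cap AT `h`
  and a sourced floor at a larger field `h₂ > h`: `hi − lo ≤ M · 2(h₂ − h)`;
* `PinFieldResponseFloorAt.of_sourcedLower_of_clusterCap_4x3` — the `4 × 3` instance (`q = 12`, `L₁ = 12`)
  in the shape of the hubbard-cq pilot's cluster runs (U arbitrary, `h = g√2` arbitrary).

References: T. Koma, H. Tasaki, J. Stat. Phys. 76 (1994) 745, §1 (Hellmann–Feynman chords of the sourced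
energy); D. Ruelle, *Statistical Mechanics* (1969) §3.3 (cluster variational principle). Tree:
`PinFieldResponseFloorAt.of_energyRows`, `PinFieldResponseCeilingAt.of_energyRows` (`PinningFieldChords`),
`sourcedEnergyUpperRow_of_exists_clusterState` (`Upper/DWaveSourceOpenClusterCap`), `SourcedEnergyLowerRow.mono`.
-/

noncomputable section

namespace Summit.Ventures.CertifiedManyBodySolver

open Matrix Literature.MathematicalPhysics.QuantumLattice Literature.MathematicalPhysics.QuantumLattice.TwoCluster
open Summit.Ventures.CertifiedManyBodySolver.Observables
open scoped ComplexOrder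

variable {a b q L₀ L₁ : ℕ} {U μ : ℝ}

/-- **FLOOR leaf from a sourced floor row at `h₁ < h` and an open-cluster cap AT `h`.** The floor row may live on
any side progression `q₀ ∣ q` (a translation-invariant window certificate has `q₀ = 1`); the cluster cap lives on
`q` with `a ∣ q`, `b ∣ q` and needs `a, b < L₁`. Slot: `m · 2(h − h₁) ≤ lo − hi`. [cite: KomaTasaki1994, §1] -/
theorem PinFieldResponseFloorAt.of_sourcedLower_of_clusterCap {q₀ : ℕ} {h₁ h : ℝ} (hlt : h₁ < h) {lo hi m : ℚ}
    (hlo : SourcedEnergyLowerRow 0 U μ h₁ q₀ L₀ lo) (hq₀ : q₀ ∣ q) (hqa : a ∣ q) (hqb : b ∣ q) (hLa : a < L₁)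
    (hLb : b < L₁)
    (hcap : ∃ ψ : Fock (Orb (Fin a ×ₗ Fin b)), HasParity 0 ψ ∧ star ψ ⬝ᵥ ψ = 1 ∧
      (star ψ ⬝ᵥ (dWaveSourceOpenBox a b U μ h *ᵥ ψ)).re ≤ ((hi : ℚ) : ℝ) * ((a : ℝ) * b))
    (hm : ((m : ℚ) : ℝ) * (2 * (h - h₁)) ≤ lo - hi) :
    PinFieldResponseFloorAt 0 U μ h q (max L₀ L₁) m :=
  PinFieldResponseFloorAt.of_energyRows hlt (hlo.mono le_rfl le_rfl hq₀)
    (sourcedEnergyUpperRow_of_exists_clusterState hqa hqb hLa hLb U μ h hcap) hm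

/-- **CEILING leaf from an open-cluster cap AT `h` and a sourced floor row at `h₂ > h`.** Slot:
`hi − lo ≤ M · 2(h₂ − h)`. A ceiling; never speaks to presence. [cite: KomaTasaki1994, §1] -/
theorem PinFieldResponseCeilingAt.of_clusterCap_of_sourcedLower {q₀ : ℕ} {h h₂ : ℝ} (hlt : h < h₂) {hi lo M : ℚ}
    (hqa : a ∣ q) (hqb : b ∣ q) (hLa : a < L₁) (hLb : b < L₁)
    (hcap : ∃ ψ : Fock (Orb (Fin a ×ₗ Fin b)), HasParity 0 ψ ∧ star ψ ⬝ᵥ ψ = 1 ∧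
      (star ψ ⬝ᵥ (dWaveSourceOpenBox a b U μ h *ᵥ ψ)).re ≤ ((hi : ℚ) : ℝ) * ((a : ℝ) * b))
    (hlo : SourcedEnergyLowerRow 0 U μ h₂ q₀ L₀ lo) (hq₀ : q₀ ∣ q)
    (hM : ((hi : ℚ) : ℝ) - lo ≤ ((M : ℚ) : ℝ) * (2 * (h₂ - h))) :
    PinFieldResponseCeilingAt 0 U μ h q (max L₁ L₀) M :=
  PinFieldResponseCeilingAt.of_energyRows hlt (sourcedEnergyUpperRow_of_exists_clusterState hqa hqb hLa hLb U μ h hcap)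
    (hlo.mono le_rfl le_rfl hq₀) hM

/-- **The `4 × 3` instance** (the hubbard-cq pilot's cluster runs; `q = L₁ = 12`): a translation-invariant sourced
floor row at `h₁` (`q₀ = 1`, onset `L₀`) and a `4 × 3` open-cluster cap AT `h > h₁` give
`PinFieldResponseFloorAt 0 U μ h 12 (max L₀ 12) m` for every `m` with `m · 2(h − h₁) ≤ lo − hi`.
[cite: KomaTasaki1994, §1] -/
theorem PinFieldResponseFloorAt.of_sourcedLower_of_clusterCap_4x3 {h₁ h : ℝ} (hlt : h₁ < h) {lo hi m : ℚ}
    (hlo : SourcedEnergyLowerRow 0 U μ h₁ 1 L₀ lo)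
    (hcap : ∃ ψ : Fock (Orb (Fin 4 ×ₗ Fin 3)), HasParity 0 ψ ∧ star ψ ⬝ᵥ ψ = 1 ∧
      (star ψ ⬝ᵥ (dWaveSourceOpenBox 4 3 U μ h *ᵥ ψ)).re ≤ ((hi : ℚ) : ℝ) * ((4 : ℕ) * ((3 : ℕ) : ℝ)))
    (hm : ((m : ℚ) : ℝ) * (2 * (h - h₁)) ≤ lo - hi) :
    PinFieldResponseFloorAt 0 U μ h 12 (max L₀ 12) m :=
  PinFieldResponseFloorAt.of_sourcedLower_of_clusterCap hlt hlo (one_dvd _) (by norm_num) (by norm_num)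
    (by norm_num) (by norm_num) hcap hm

/-- The `4 × 3` CEILING instance: cap AT `h`, translation-invariant sourced floor at `h₂ > h`.
[cite: KomaTasaki1994, §1] -/
theorem PinFieldResponseCeilingAt.of_clusterCap_of_sourcedLower_4x3 {h h₂ : ℝ} (hlt : h < h₂) {hi lo M : ℚ}
    (hcap : ∃ ψ : Fock (Orb (Fin 4 ×ₗ Fin 3)), HasParity 0 ψ ∧ star ψ ⬝ᵥ ψ = 1 ∧
      (star ψ ⬝ᵥ (dWaveSourceOpenBox 4 3 U μ h *ᵥ ψ)).re ≤ ((hi : ℚ) : ℝ) * ((4 : ℕ) * ((3 : ℕ) : ℝ)))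
    (hlo : SourcedEnergyLowerRow 0 U μ h₂ 1 L₀ lo)
    (hM : ((hi : ℚ) : ℝ) - lo ≤ ((M : ℚ) : ℝ) * (2 * (h₂ - h))) :
    PinFieldResponseCeilingAt 0 U μ h 12 (max 12 L₀) M :=
  PinFieldResponseCeilingAt.of_clusterCap_of_sourcedLower hlt (by norm_num) (by norm_num) (by norm_num)
    (by norm_num) hcap hlo (one_dvd _) hM

end Summit.Ventures.CertifiedManyBodySolver

end
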